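import Summits.RiemannHypothesis.RiemannHypothesis.Theses.LiPrimeEcho
import Summits.RiemannHypothesis.RiemannHypothesis.Theorems.LiPrimeEchoWindowAdjust
import Literature.NumberTheory.LFunctions.RiemannXiLogDeriv
import Literature.NumberTheory.LFunctions.WeilExplicitFormulaProofs
import Literature.NumberTheory.LFunctions.RiemannSiegelFacts
import Literature.Analysis.Complex.WeightedArgumentPrinciple
import HarnessLib

/-!
# RiemannHypothesis / LiPrimeEcho — crux K1 `LiWindowContour`: Bombieri's rectangle for `F_n · ξ'/ξ` (RH-FREE)

RH-FREE [rh-li-prover].  Route `Theses/LiPrimeEcho.lean` (rung «Li PRIME-ECHO LAW» `LiTheory.LiZeroWindowEcho`, L-P(P1e);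
cell `pub/rh-li`, theory memo `theory/TARGETS.md` §7.10 steps A–B / §12), item `LiWindowContour`
(stmt-RiemannHypothesis-19246): at good heights `1 ≤ T₁ < T₂`,

  `liZeroTraceWindow n T₁ T₂ = liPolarEdge n T₁ T₂ + liGammaEdge n T₁ T₂ − liPrimeEdge n T₁ T₂ + liHorizTerm n T₁ − liHorizTerm n T₂`.

Proof (the pattern of the tree's `weilZeroSidePartial_eq_contour`): the weighted argument principle
(`Literature.Analysis.Complex.integral_boundary_rect_logDeriv_mul`) on `[−1/2, 3/2] × [T₁, T₂]` for `ξ` and the weight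
`F_n(s) = (1 − 1/s)ⁿ` (analytic there) gives `2πi Σ_{T₁<Im ρ<T₂} m(ρ) F_n(ρ)` = boundary integral, the residues
being the window's zeros at ANY real part with multiplicity `riemannZetaZeroOrder` (`untop₀_meromorphicOrderAt_riemannXi`);
conjugation symmetry of `liZeroBox` gives `liZeroTraceWindow = 2 Re Σ` (`WindowAdjust.liZeroTrace_sub_eq`); the left
edge `Re w = −1/2` is folded onto `Re w = 3/2` by `ξ'/ξ(1 − s) = −ξ'/ξ(s)` and `ξ'/ξ(s̄) = conj` (`logDeriv_riemannXi_one_sub`,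
`logDeriv_riemannXi_conj`), producing `k_n = F_n(w) + F_n(1 − w)`; finally on `Re w = 3/2`,
`ξ'/ξ = 1/w + 1/(w − 1) − ½ log π + ½ ψ(w/2) − L(Λ, w)` (`logDeriv_riemannXi_eq_of_one_lt_re`) splits the right edge.
The identity holds whatever the real parts of the zeros are; nothing here bears on the truth of RH.
-/

noncomputable section

-- D-0017: `Summit.<S>.<S>.…` is the designed namespace of a single-problem summit.
set_option linter.dupNamespace false

open Complex MeasureTheory intervalIntegral Set
open scoped Real Interval ComplexConjugate ArithmeticFunction.vonMangoldt

namespace Summit.RiemannHypothesis.RiemannHypothesis.Theorems.LiTheory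

open Literature.NumberTheory.LFunctions Literature.NumberTheory.LFunctions.SchoenfeldBound

namespace WindowContour

/-! ### The weight -/

/-- `F_n(s̄) = conj F_n(s)`. -/
theorem liWeight_conj (n : ℕ) (s : ℂ) : liWeight n (conj s) = conj (liWeight n s) := by
  unfold liWeight
  rw [map_pow]; congr 1; simp [map_sub]

/-- `F_n` is analytic away from `0`. -/
theorem analyticAt_liWeight (n : ℕ) {s : ℂ} (hs : s ≠ 0) : AnalyticAt ℂ (liWeight n) s := by
  unfold liWeight
  exact ((analyticAt_const.sub (analyticAt_const.div analyticAt_id hs)).pow n)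

/-- `((3/2 : ℝ) : ℂ) = 3/2` and the right-edge point. -/
theorem liRightPt_eq (y : ℝ) : liRightPt y = (((3 / 2 : ℝ) : ℂ) + y * I) := by
  unfold liRightPt; push_cast; ring

/-! ### The residues are the window zeros, at any real part -/

/-- At good heights, the zero set of `ξ` in the open rectangle `(−1/2, 3/2) × (T₁, T₂)` is `zerosBetween T₁ T₂`. -/
theorem zeroSet_eq {T₁ T₂ : ℝ} (hT₁ : 0 < T₁) (hgood : T₂ ∈ liGoodHeights) :
    {ρ : ℂ | riemannXi ρ = 0 ∧ ρ ∈ Ioo (-(1 / 2) : ℝ) (3 / 2) ×ℂ Ioo T₁ T₂} = ↑(zerosBetween T₁ T₂) := by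
  ext ρ
  simp only [mem_setOf_eq, Complex.mem_reProdIm, mem_Ioo, Finset.mem_coe]
  rw [mem_zerosBetween hT₁.le]
  constructor
  · rintro ⟨h0, -, hi1, hi2⟩
    obtain ⟨hζ, hre0, hre1, -⟩ := riemannXi_zero_prop h0
    exact ⟨hζ, hre0.le, hre1.le, hi1, hi2.le⟩
  · rintro ⟨hζ, h0, h1, hi1, hi2⟩
    have him : ρ.im ≠ 0 := by intro h; rw [h] at hi1; linarith
    have hmem : ρ ∈ ZetaZeros.riemannZetaNontrivialZeros :=
      ZetaZeros.riemannZetaNontrivialZeros.mem_of_im_ne_zero hζ him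
    have hxi : riemannXi ρ = 0 := riemannXi_eq_zero_of_mem_riemannZetaNontrivialZeros hmem
    have hne : ρ.im ≠ T₂ := by
      intro h
      have := hgood ρ.re ⟨by linarith, by linarith⟩
      rw [← h, Complex.re_add_im] at this
      exact this hxi
    refine ⟨hxi, ⟨by linarith, by linarith⟩, hi1, lt_of_le_of_ne hi2 hne⟩

/-- The residue sum is the window's Li sum: `Σᶠ_{ξ(ρ)=0, ρ ∈ rect°} m_ξ(ρ) F_n(ρ) = Σ_{zerosBetween T₁ T₂} m(ρ)(1 − 1/ρ)ⁿ`. -/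
theorem residueSum_eq (n : ℕ) {T₁ T₂ : ℝ} (hT₁ : 0 < T₁) (hgood : T₂ ∈ liGoodHeights) :
    (∑ᶠ ρ ∈ {ρ : ℂ | riemannXi ρ = 0 ∧ ρ ∈ Ioo (-(1 / 2) : ℝ) (3 / 2) ×ℂ Ioo T₁ T₂},
        ((meromorphicOrderAt riemannXi ρ).untop₀ : ℂ) * liWeight n ρ) =
      ∑ ρ ∈ zerosBetween T₁ T₂, (riemannZetaZeroOrder ρ : ℂ) * (1 - 1 / ρ) ^ n := by
  rw [zeroSet_eq hT₁ hgood, finsum_mem_coe_finset]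
  refine Finset.sum_congr rfl fun ρ hρ ↦ ?_
  obtain ⟨hζ, -, -, hi1, -⟩ := (mem_zerosBetween hT₁.le).1 hρ
  have him : ρ.im ≠ 0 := by intro h; rw [h] at hi1; linarith
  have hmem := ZetaZeros.riemannZetaNontrivialZeros.mem_of_im_ne_zero hζ him
  rw [untop₀_meromorphicOrderAt_riemannXi (ZetaZeros.riemannZetaNontrivialZeros.re_pos hmem)
    (ZetaZeros.riemannZetaNontrivialZeros.ne_one hmem)]
  rfl

/-- The windowed trace is twice the real part of the window's Li sum. -/
theorem liZeroTraceWindow_eq_two_re (n : ℕ) {T₁ T₂ : ℝ} (hT₁ : 0 ≤ T₁) (hT : T₁ ≤ T₂) :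
    liZeroTraceWindow n T₁ T₂ =
      2 * (∑ ρ ∈ zerosBetween T₁ T₂, (riemannZetaZeroOrder ρ : ℂ) * (1 - 1 / ρ) ^ n).re := by
  unfold liZeroTraceWindow
  rw [WindowAdjust.liZeroTrace_sub_eq n hT₁ hT, Complex.re_sum]
  congr 1
  refine Finset.sum_congr rfl fun ρ _ ↦ ?_
  simp [Complex.mul_re]

/-! ### Bombieri's rectangle: the left edge folded -/

/-- **Stub A (the contour identity with the left edge folded).**  At good heights `1 ≤ T₁ < T₂`:
`liZeroTraceWindow n T₁ T₂ = liRightEdge n T₁ T₂ + liHorizTerm n T₁ − liHorizTerm n T₂`. -/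
theorem window_contour (n : ℕ) {T₁ T₂ : ℝ} (h1 : 1 ≤ T₁) (hlt : T₁ < T₂) (hg1 : T₁ ∈ liGoodHeights)
    (hg2 : T₂ ∈ liGoodHeights) :
    liZeroTraceWindow n T₁ T₂ = liRightEdge n T₁ T₂ + liHorizTerm n T₁ - liHorizTerm n T₂ := by
  have hT₁ : 0 < T₁ := by linarith
  have hπ := Real.pi_pos
  -- the weighted argument principle
  have key := Literature.Analysis.Complex.integral_boundary_rect_logDeriv_mul (f := riemannXi) (g := liWeight n)
    (a := -(1 / 2)) (b := 3 / 2) (c := T₁) (d := T₂) (by norm_num) hlt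
    (fun z _ ↦ differentiable_riemannXi.analyticAt z)
    (fun z hz ↦ analyticAt_liWeight n (by
      intro h0
      have hz2 := (Complex.mem_reProdIm.1 hz).2
      rw [h0, Complex.zero_im] at hz2
      linarith [hz2.1]))
    (fun x hx ↦ hg1 x hx) (fun x hx ↦ hg2 x hx)
    (fun y _ ↦ riemannXi_ne_zero_of_re_le_zero (by simp))
    (fun y _ ↦ riemannXi_ne_zero_of_one_le_re (by simp; norm_num))
  simp only [← logDeriv_apply] at key
  rw [residueSum_eq n hT₁ hg2] at key
  -- names for the four edges
  set Z : ℂ := ∑ ρ ∈ zerosBetween T₁ T₂, (riemannZetaZeroOrder ρ : ℂ) * (1 - 1 / ρ) ^ n with hZ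
  set Ibot := ∫ x : ℝ in (-(1 / 2) : ℝ)..(3 / 2), logDeriv riemannXi (x + T₁ * I) * liWeight n (x + T₁ * I) with hIbot
  set Itop := ∫ x : ℝ in (-(1 / 2) : ℝ)..(3 / 2), logDeriv riemannXi (x + T₂ * I) * liWeight n (x + T₂ * I) with hItop
  set IR := ∫ y : ℝ in T₁..T₂, logDeriv riemannXi (((3 / 2 : ℝ) : ℂ) + y * I) *
    liWeight n (((3 / 2 : ℝ) : ℂ) + y * I) with hIR
  set IR' := ∫ y : ℝ in T₁..T₂, logDeriv riemannXi (((3 / 2 : ℝ) : ℂ) + y * I) *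
    liWeight n (1 - (((3 / 2 : ℝ) : ℂ) + y * I)) with hIR'
  set IL := ∫ y : ℝ in T₁..T₂, logDeriv riemannXi (((-(1 / 2) : ℝ) : ℂ) + y * I) *
    liWeight n (((-(1 / 2) : ℝ) : ℂ) + y * I) with hIL
  -- `key : Ibot − Itop + I IR − I IL = 2πi Z`
  -- fold the left edge: its integrand is `−conj(ξ'/ξ(w) F_n(1 − w))`, `w = 3/2 + iy`
  have hfold : IL = -conj IR' := by
    have e : ∀ y : ℝ, logDeriv riemannXi (((-(1 / 2) : ℝ) : ℂ) + y * I) * liWeight n (((-(1 / 2) : ℝ) : ℂ) + y * I) =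
        -conj (logDeriv riemannXi (((3 / 2 : ℝ) : ℂ) + y * I) * liWeight n (1 - (((3 / 2 : ℝ) : ℂ) + y * I))) := by
      intro y
      have h1 : (((-(1 / 2) : ℝ) : ℂ) + y * I) = 1 - conj (((3 / 2 : ℝ) : ℂ) + y * I) := by
        apply Complex.ext
        · simp only [Complex.add_re, Complex.ofReal_re, Complex.mul_re, Complex.I_re, Complex.ofReal_im,
            Complex.I_im, Complex.sub_re, Complex.one_re, Complex.conj_re]
          norm_num
        · simp only [Complex.add_im, Complex.ofReal_re, Complex.mul_im, Complex.I_re, Complex.ofReal_im,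
            Complex.I_im, Complex.sub_im, Complex.one_im, Complex.conj_im]
          norm_num
      have h2 : (((-(1 / 2) : ℝ) : ℂ) + y * I) = conj (1 - (((3 / 2 : ℝ) : ℂ) + y * I)) := by
        rw [h1, map_sub, map_one]
      conv_lhs => rw [h1]
      rw [logDeriv_riemannXi_one_sub, logDeriv_riemannXi_conj, ← h1, h2, liWeight_conj, map_mul]
      ring
    rw [hIL, intervalIntegral.integral_congr (fun y _ ↦ e y), intervalIntegral.integral_neg,
      intervalIntegral.integral_of_le hlt.le, integral_conj, ← intervalIntegral.integral_of_le hlt.le]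
  -- real parts: `Re Z = (Im ∮)/(2π)`
  have hZre : liZeroTraceWindow n T₁ T₂ = 2 * Z.re := liZeroTraceWindow_eq_two_re n hT₁.le hlt.le
  have h2Zre : 2 * Z.re = 1 / Real.pi * (Ibot.im - Itop.im + IR.re - IL.re) := by
    have hIm := congrArg Complex.im key
    simp only [Complex.sub_im, Complex.add_im, Complex.mul_im, Complex.I_re, Complex.I_im, Complex.mul_re,
      Complex.ofReal_re, Complex.ofReal_im, Complex.re_ofNat, Complex.im_ofNat, zero_mul, one_mul, mul_zero,
      mul_one, zero_add, add_zero, sub_zero] at hIm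
    field_simp
    linarith
  have hILre : IL.re = -IR'.re := by rw [hfold, Complex.neg_re, Complex.conj_re]
  -- the right edge is `IR + IR'`
  have hc : Continuous fun y : ℝ ↦ logDeriv riemannXi (((3 / 2 : ℝ) : ℂ) + y * I) :=
    continuous_logDeriv_riemannXi_vertical (by norm_num)
  have hw0 : ∀ y : ℝ, (((3 / 2 : ℝ) : ℂ) + y * I) ≠ 0 := fun y h ↦ by
    have := congrArg Complex.re h; norm_num at this
  have hw1 : ∀ y : ℝ, 1 - (((3 / 2 : ℝ) : ℂ) + y * I) ≠ 0 := fun y h ↦ by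
    have := congrArg Complex.re h; norm_num at this
  have hcw : Continuous fun y : ℝ ↦ (((3 / 2 : ℝ) : ℂ) + y * I) := by fun_prop
  have hcw' : Continuous fun y : ℝ ↦ 1 - (((3 / 2 : ℝ) : ℂ) + y * I) := by fun_prop
  have hcF : Continuous fun y : ℝ ↦ liWeight n (((3 / 2 : ℝ) : ℂ) + y * I) := by
    refine continuous_iff_continuousAt.2 fun y ↦ ?_
    show ContinuousAt ((liWeight n) ∘ fun y : ℝ ↦ (((3 / 2 : ℝ) : ℂ) + y * I)) y
    exact ContinuousAt.comp (analyticAt_liWeight n (hw0 y)).continuousAt hcw.continuousAt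
  have hcF' : Continuous fun y : ℝ ↦ liWeight n (1 - (((3 / 2 : ℝ) : ℂ) + y * I)) := by
    refine continuous_iff_continuousAt.2 fun y ↦ ?_
    show ContinuousAt ((liWeight n) ∘ fun y : ℝ ↦ 1 - (((3 / 2 : ℝ) : ℂ) + y * I)) y
    exact ContinuousAt.comp (analyticAt_liWeight n (hw1 y)).continuousAt hcw'.continuousAt
  have i1 : IntervalIntegrable (fun y : ℝ ↦ logDeriv riemannXi (((3 / 2 : ℝ) : ℂ) + y * I) *
      liWeight n (((3 / 2 : ℝ) : ℂ) + y * I)) volume T₁ T₂ := (hc.mul hcF).intervalIntegrable _ _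
  have i2 : IntervalIntegrable (fun y : ℝ ↦ logDeriv riemannXi (((3 / 2 : ℝ) : ℂ) + y * I) *
      liWeight n (1 - (((3 / 2 : ℝ) : ℂ) + y * I))) volume T₁ T₂ := (hc.mul hcF').intervalIntegrable _ _
  have hright : liRightEdge n T₁ T₂ = 1 / Real.pi * (IR + IR').re := by
    unfold liRightEdge
    rw [hIR, hIR', ← intervalIntegral.integral_add i1 i2]
    congr 2
    refine intervalIntegral.integral_congr fun y _ ↦ ?_
    rw [liRightPt_eq, liSymWeight]
    ring
  have hbot : liHorizTerm n T₁ = 1 / Real.pi * Ibot.im := rfl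
  have htop : liHorizTerm n T₂ = 1 / Real.pi * Itop.im := rfl
  rw [hZre, h2Zre, hright, hbot, htop, hILre, Complex.add_re]
  ring

/-! ### The right edge splits -/

/-- **Stub B (splitting the right edge).**  For any `T₁, T₂`:
`liRightEdge = liPolarEdge + liGammaEdge − liPrimeEdge` (`ξ'/ξ = 1/w + 1/(w−1) − ½log π + ½ψ(w/2) − L(Λ,w)` on `Re w = 3/2`). -/
theorem rightEdge_split (n : ℕ) (T₁ T₂ : ℝ) :
    liRightEdge n T₁ T₂ = liPolarEdge n T₁ T₂ + liGammaEdge n T₁ T₂ - liPrimeEdge n T₁ T₂ := by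
  -- continuity of the pieces on the edge
  have hw : ∀ y : ℝ, (liRightPt y).re = 3 / 2 := fun y ↦ by simp [liRightPt]
  have hw0 : ∀ y : ℝ, liRightPt y ≠ 0 := fun y h ↦ by have := hw y; rw [h] at this; norm_num at this
  have hw1 : ∀ y : ℝ, liRightPt y - 1 ≠ 0 := fun y h ↦ by
    have := congrArg Complex.re h; simp [liRightPt] at this; norm_num at this
  have hw1' : ∀ y : ℝ, 1 - liRightPt y ≠ 0 := fun y h ↦ hw1 y (by rw [← neg_sub, h, neg_zero])
  have hcw : Continuous liRightPt := by unfold liRightPt; fun_prop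
  have hcw' : Continuous fun y : ℝ ↦ 1 - liRightPt y := continuous_const.sub hcw
  have hck : Continuous fun y : ℝ ↦ liSymWeight n (liRightPt y) := by
    refine continuous_iff_continuousAt.2 fun y ↦ ?_
    have h1 : ContinuousAt ((liWeight n) ∘ liRightPt) y :=
      ContinuousAt.comp (analyticAt_liWeight n (hw0 y)).continuousAt hcw.continuousAt
    have h2 : ContinuousAt ((liWeight n) ∘ fun y : ℝ ↦ 1 - liRightPt y) y :=
      ContinuousAt.comp (analyticAt_liWeight n (hw1' y)).continuousAt hcw'.continuousAt
    exact h1.add h2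
  have hcxi : Continuous fun y : ℝ ↦ logDeriv riemannXi (liRightPt y) := by
    have := continuous_logDeriv_riemannXi_vertical (c := 3 / 2) (by norm_num)
    refine this.congr fun y ↦ ?_
    rw [liRightPt_eq]
  have hcpol : Continuous fun y : ℝ ↦ (1 / liRightPt y + 1 / (liRightPt y - 1)) := by
    refine continuous_iff_continuousAt.2 fun y ↦ ?_
    have h1 : ContinuousAt (fun y : ℝ ↦ 1 / liRightPt y) y :=
      (continuousAt_const.div hcw.continuousAt (hw0 y))
    have h2 : ContinuousAt (fun y : ℝ ↦ 1 / (liRightPt y - 1)) y :=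
      (continuousAt_const.div (hcw.continuousAt.sub continuousAt_const) (hw1 y))
    exact h1.add h2
  have hcgam : Continuous fun y : ℝ ↦ (-(Real.log Real.pi : ℂ) / 2 + 1 / 2 * Complex.digamma (liRightPt y / 2)) := by
    refine continuous_iff_continuousAt.2 fun y ↦ ?_
    have hψ : ContinuousAt (fun y : ℝ ↦ Complex.digamma (liRightPt y / 2)) y :=
      (continuousAt_digamma_of_re_pos (by rw [Complex.div_ofNat_re, hw y]; norm_num)).comp
        (hcw.continuousAt.div_const 2)
    exact continuousAt_const.add (continuousAt_const.mul hψ)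
  set A : ℝ → ℂ := fun y ↦ (1 / liRightPt y + 1 / (liRightPt y - 1)) * liSymWeight n (liRightPt y) with hA
  set B : ℝ → ℂ := fun y ↦ (-(Real.log Real.pi : ℂ) / 2 + 1 / 2 * Complex.digamma (liRightPt y / 2)) *
    liSymWeight n (liRightPt y) with hB
  set X : ℝ → ℂ := fun y ↦ logDeriv riemannXi (liRightPt y) * liSymWeight n (liRightPt y) with hX
  set C : ℝ → ℂ := fun y ↦ LSeries (fun m ↦ (Λ m : ℂ)) (liRightPt y) * liSymWeight n (liRightPt y) with hC
  have iA : IntervalIntegrable A volume T₁ T₂ := (hcpol.mul hck).intervalIntegrable _ _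
  have iB : IntervalIntegrable B volume T₁ T₂ := (hcgam.mul hck).intervalIntegrable _ _
  have iX : IntervalIntegrable X volume T₁ T₂ := (hcxi.mul hck).intervalIntegrable _ _
  -- pointwise: `X = A + B − C`
  have hsplit : ∀ y : ℝ, X y = A y + B y - C y := by
    intro y
    simp only [hX, hA, hB, hC]
    rw [logDeriv_riemannXi_eq_of_one_lt_re (by rw [hw y]; norm_num)]
    simp only [LSeries]
    ring
  have iC : IntervalIntegrable C volume T₁ T₂ := by
    have := (iA.add iB).sub iX
    refine this.congr fun y _ ↦ ?_
    show A y + B y - X y = C y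
    rw [hsplit y]
    ring
  have hint : ∫ y in T₁..T₂, X y = (∫ y in T₁..T₂, A y) + (∫ y in T₁..T₂, B y) - ∫ y in T₁..T₂, C y := by
    rw [← intervalIntegral.integral_add iA iB, ← intervalIntegral.integral_sub (iA.add iB) iC]
    exact intervalIntegral.integral_congr fun y _ ↦ hsplit y
  unfold liRightEdge liPolarEdge liGammaEdge liPrimeEdge
  change 1 / Real.pi * (∫ y in T₁..T₂, X y).re =
    1 / Real.pi * (∫ y in T₁..T₂, A y).re + 1 / Real.pi * (∫ y in T₁..T₂, B y).re - 1 / Real.pi * (∫ y in T₁..T₂, C y).re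
  rw [hint, Complex.sub_re, Complex.add_re]
  ring

end WindowContour

open WindowContour in
/-- **Crux K1 `LiWindowContour` of route `LiPrimeEcho`** (stmt-RiemannHypothesis-19246; RH-FREE): at good heights
`1 ≤ T₁ < T₂`, `liZeroTraceWindow n T₁ T₂ = liPolarEdge + liGammaEdge − liPrimeEdge + liHorizTerm T₁ − liHorizTerm T₂`.
Verbatim the route statement. -/
theorem liWindowContour_eq :
    ∀ (n : ℕ) (T₁ T₂ : ℝ), 1 ≤ T₁ → T₁ < T₂ → T₁ ∈ liGoodHeights → T₂ ∈ liGoodHeights →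
      liZeroTraceWindow n T₁ T₂ = liPolarEdge n T₁ T₂ + liGammaEdge n T₁ T₂ - liPrimeEdge n T₁ T₂ +
        liHorizTerm n T₁ - liHorizTerm n T₂ := by
  intro n T₁ T₂ h1 hlt hg1 hg2
  rw [window_contour n h1 hlt hg1 hg2, rightEdge_split n T₁ T₂]

/-- **Item `LiWindowContour` of route `LiPrimeEcho`** (stmt-RiemannHypothesis-19246), closed BY NAME. -/
theorem liWindowContour_proof : Summit.RiemannHypothesis.RiemannHypothesis.Theses.LiPrimeEcho.LiWindowContour :=
  liWindowContour_eq

end Summit.RiemannHypothesis.RiemannHypothesis.Theorems.LiTheory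

end
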